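import Literature.NumberTheory.EllipticCurves.CongruentNumberCurveHeckeSeries
import Literature.NumberTheory.EllipticCurves.CongruentNumberCurveJacobiSums
import Literature.NumberTheory.EllipticCurves.ComplexMultiplicationDeuringRamified1728Proofs
import HarnessLib

/-!
# The Dirichlet coefficients of `L(E_D, s)`, `E_D : y² = x³ − Dx`, at prime powers (Ireland–Rosen Ch. 18 §§4–6)

Topic `Literature/NumberTheory/EllipticCurves`, namespace `Literature.NumberTheory.EllipticCurves.QuarticTwist`.
Theorems only (no definition, no named fact).  The `D`-general twin of the prime-power half of
`CongruentNumberCurveHeckeSeries` (which treats `D = n²`): for Mathlib's `WeierstrassCurve.LFunction` of the quartic twist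
`E_D = ⟨0, 0, 0, -D, 0⟩ / ℚ` (`D ∈ ℤ ∖ 0`, not divisible by a fourth power of the prime in question where this matters),

* §1 the models (`Δ = 64 D³`, `c₄ = 48 D`, base change of the `ℤ`-model);
* §2 **additive primes** `p ∣ 2D`: `E_D` has additive reduction at `p` (`p = 2`: the tree's Tate/Kraus analysis
  `hasAdditiveReductionAt_two_mk_pow_mul_odd`; `p` odd, `p ∥^k D`, `1 ≤ k ≤ 3`: Silverman VII.5.1(c) with `0 < ord_p Δ = 3k < 12`),
  hence `a_{p^{k+1}}(E_D) = 0` (Ireland–Rosen: «If `P` divides `2D` define `χ(P) = 0`»);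
* §3 **inert primes** `p ≡ 3 (4)`, `p ∤ D`: `a_p = 0` (Theorem 5: `N_p = p + 1`), `a_{p^{2m}} = (-p)^m`, `a_{p^{2m+1}} = 0`
  («`1 - a_p p^{-s} + p^{1-2s} = 1 + p^{1-2s} = 1 - χ(P)NP^{-s}`», `χ((p)) = -p`);
* §4 **split primes** `p ≡ 1 (4)`, `p ∤ D`, `p = N(π)`, `π ≡ 1 (2 + 2i)`, `u ∈ ℤ[i]` a fourth root of unity with
  `π ∣ D^{(p-1)/4} − u` (i.e. `u = (D/π)₄`): **`a_p(E_D) = ū π + u π̄`** (Theorem 5, second assertion — the tree's PROVED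
  `IrelandRosen1990_card_points_one_mod_four_holds`) and `a_{p^k} = Σ_{j ≤ k} (ūπ)^j (uπ̄)^{k-j}`
  («`1 - a_p p^{-s} + p^{1-2s} = (1 - χ(P)NP^{-s})(1 - χ(P̄)NP̄^{-s})`», `χ(P) = \overline{(D/π)₄} π`).

These are the Euler factors of Ireland–Rosen's Theorem 18.7 `L(E_D, s) = L(s, χ_D)` read on Mathlib's arithmetic
function `n ↦ a_n(E_D)`; the regrouping into `a_n = Σ_{N𝔞 = n} χ_D(𝔞)` (with the quartic symbol of
`QuadraticFields/GaussianQuarticSymbol`) is done in the sequel `QuarticTwistThetaDictionary`.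

## References
* K. Ireland, M. Rosen, *A Classical Introduction to Modern Number Theory*, 2nd ed., GTM 84 (1990), Ch. 18 §4 Theorem 5,
  §6 Theorem 7 and its proof (PDF pp. 301–304). [IrelandRosen1990]
* J. H. Silverman, *The Arithmetic of Elliptic Curves*, 2nd ed. (2009), VII.1 Remark 1.1, VII.5 Prop. 5.1, §C.16. [SilvermanAEC2009]
* F. Diamond, J. Shurman, *A First Course in Modular Forms*, GTM 228, §8.8 (8.44). [DiamondShurman2005]

## Mathlib / tree search
Tree: `IrelandRosen1990_card_points_one_mod_four_holds` (`CongruentNumberCurveJacobiSums`), `IrelandRosen1990_card_points_three_mod_four`,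
`hasGoodReductionAt_map_of_not_dvd` (`CongruentNumberCurveSupersingular`), `hasAdditiveReductionAt_of_valuation`,
`lFunction_apply_eq_zero_of_hasAdditiveReductionAt` (`CongruentNumberCurveAdditiveReduction`),
`hasAdditiveReductionAt_two_mk_pow_mul_odd` (`ComplexMultiplicationDeuringRamified1728Proofs`),
`Automorphic.lFunction_map_apply_prime_of_not_dvd`, `WeierstrassCurve.LFunction_apply_prime_pow_add_two`,
`isMultiplicative_LFunction`, `GaussianPrimary.{isPrimary_iff_dvd, natCast_eq_mul_star, sum_pow_mul_pow_rec, eq_of_isUnit}`,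
`Rat.valuation_intCast_eq_one/_natGenerator/_intCast`.  The `D = n²` case is `lFunction_congruentNumberCurve_apply_prime_*`
(`CongruentNumberCurveHeckeSeries`); no general-`D` statement existed (`lean search 'quarticTwist|⟨0, 0, 0, -'`).
-/

noncomputable section

open scoped Classical

namespace Literature.NumberTheory.EllipticCurves

namespace QuarticTwist

open WeierstrassCurve IsDedekindDomain Rat.HeightOneSpectrum
open Literature.NumberTheory.QuadraticFields.GaussianPrimary Literature.NumberTheory.GaloisRepresentations

variable {D : ℤ}

/-! ### §1 The models `⟨0, 0, 0, -D, 0⟩` over `ℤ` and `ℚ` -/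

/-- The `ℤ`-model of `E_D` base-changes to `⟨0, 0, 0, -D, 0⟩ / ℚ`. [folklore] -/
private theorem map_int (D : ℤ) :
    (⟨0, 0, 0, -D, 0⟩ : WeierstrassCurve ℤ).map (Int.castRingHom ℚ) = (⟨0, 0, 0, -(D : ℚ), 0⟩ : WeierstrassCurve ℚ) := by
  simp [WeierstrassCurve.map]

/-- **`Δ(E_D) = 64 D³ = 2⁶ D³`** on the `ℤ`-model. [cite: IrelandRosen1990, Ch. 18 §4 (PDF p. 300, `Δ = 2⁶D³`)] -/
theorem Δ_int (D : ℤ) : (⟨0, 0, 0, -D, 0⟩ : WeierstrassCurve ℤ).Δ = 64 * D ^ 3 := by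
  simp only [WeierstrassCurve.Δ, WeierstrassCurve.b₂, WeierstrassCurve.b₄, WeierstrassCurve.b₆, WeierstrassCurve.b₈]
  ring

/-- `Δ(E_D) = 64 D³` over `ℚ`. [cite: IrelandRosen1990, Ch. 18 §4 (PDF p. 300, `Δ = 2⁶D³`)] -/
theorem Δ_rat (D : ℤ) : (⟨0, 0, 0, -(D : ℚ), 0⟩ : WeierstrassCurve ℚ).Δ = 64 * (D : ℚ) ^ 3 := by
  simp only [WeierstrassCurve.Δ, WeierstrassCurve.b₂, WeierstrassCurve.b₄, WeierstrassCurve.b₆, WeierstrassCurve.b₈]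
  ring

/-- `c₄(E_D) = 48 D` over `ℚ`. [cite: SilvermanAEC2009, III.1 (formulas for `c₄`)] -/
theorem c₄_rat (D : ℤ) : (⟨0, 0, 0, -(D : ℚ), 0⟩ : WeierstrassCurve ℚ).c₄ = 48 * (D : ℚ) := by
  simp only [WeierstrassCurve.c₄, WeierstrassCurve.b₂, WeierstrassCurve.b₄]
  ring

/-- A prime not dividing `2D` does not divide `Δ(E_D) = 64 D³` («we will only consider primes `p` such that `p ≠ 2` and
`p ∤ D`»). [cite: IrelandRosen1990, Ch. 18 §4 (PDF p. 300)] -/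
theorem not_dvd_Δ_int {p : ℕ} (hp : p.Prime) (h : ¬ (p : ℤ) ∣ 2 * D) :
    ¬ (p : ℤ) ∣ (⟨0, 0, 0, -D, 0⟩ : WeierstrassCurve ℤ).Δ := by
  rw [Δ_int]
  have hp' : Prime (p : ℤ) := Nat.prime_iff_prime_int.mp hp
  intro hd
  rcases hp'.dvd_or_dvd hd with h64 | hD3
  · exact h ((hp'.dvd_of_dvd_pow (show (p : ℤ) ∣ 2 ^ 6 by norm_num at h64 ⊢; exact h64)).mul_right D)
  · exact h ((hp'.dvd_of_dvd_pow hD3).mul_left 2)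

/-- `E_D / ℚ` is an elliptic curve for `D ≠ 0`. [cite: IrelandRosen1990, Ch. 18 §4 (PDF p. 300, `Δ = 2⁶D³ ≠ 0`)] -/
theorem isElliptic_rat (hD : D ≠ 0) : (⟨0, 0, 0, -(D : ℚ), 0⟩ : WeierstrassCurve ℚ).IsElliptic := by
  rw [WeierstrassCurve.isElliptic_iff, Δ_rat, isUnit_iff_ne_zero]
  exact mul_ne_zero (by norm_num) (pow_ne_zero _ (Int.cast_ne_zero.mpr hD))

/-- `D = p^e · m` with `p ∤ m`, for `D ≠ 0`. [folklore] -/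
private theorem exists_eq_pow_mul_not_dvd (hD : D ≠ 0) {p : ℕ} (hp : p.Prime) :
    ∃ (e : ℕ) (m : ℤ), D = (p : ℤ) ^ e * m ∧ ¬ (p : ℤ) ∣ m := by
  obtain ⟨e, n', hn', hDn⟩ := Nat.exists_eq_pow_mul_and_not_dvd (Int.natAbs_ne_zero.mpr hD) p hp.ne_one
  have hn'' : ¬ (p : ℤ) ∣ (n' : ℤ) := by exact_mod_cast hn'
  rcases Int.natAbs_eq D with h | h
  · refine ⟨e, n', ?_, hn''⟩
    conv_lhs => rw [h, hDn]
    push_cast; ring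
  · refine ⟨e, -n', ?_, by rwa [dvd_neg]⟩
    conv_lhs => rw [h, hDn]
    push_cast; ring

/-! ### §2 The additive primes `p ∣ 2D` -/

section Additive

variable (v : HeightOneSpectrum (NumberField.RingOfIntegers ℚ))

/-- **`E_D` has additive reduction at an odd prime `p` with `p ∣ D`, `p⁴ ∤ D`**: the equation is `p`-integral with
`ord_p Δ = ord_p(64 D³) = 3 ord_p D ∈ (0, 12)` and `ord_p c₄ = ord_p(48 D) > 0` (Silverman VII.1 Remark 1.1, VII.5 Prop. 5.1 (c)).
[cite: SilvermanAEC2009, VII.5 Prop. 5.1(c) and VII.1 Remark 1.1] -/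
theorem hasAdditiveReductionAt_of_odd (hD : D ≠ 0) (hp2 : natGenerator v ≠ 2)
    (hpD : (natGenerator v : ℤ) ∣ D) (hD4 : ¬ (natGenerator v : ℤ) ^ 4 ∣ D) :
    (⟨0, 0, 0, -(D : ℚ), 0⟩ : WeierstrassCurve ℚ).HasAdditiveReductionAt v := by
  have hp := prime_natGenerator v
  obtain ⟨e, m, hDe, hm⟩ := exists_eq_pow_mul_not_dvd hD hp
  have he1 : 1 ≤ e := by
    by_contra h0
    have : e = 0 := by omega
    subst this
    rw [pow_zero, one_mul] at hDe
    exact hm (hDe ▸ hpD)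
  have he3 : e ≤ 3 := by
    by_contra h4
    apply hD4
    rw [hDe]
    exact (pow_dvd_pow _ (by omega)).mul_right m
  have hvm : v.valuation ℚ (m : ℚ) = 1 := Rat.valuation_intCast_eq_one v hm
  have hvD : v.valuation ℚ (D : ℚ) = WithZero.exp (-(e : ℤ)) := by
    rw [hDe]; push_cast
    rw [Valuation.map_mul, Valuation.map_pow, Rat.valuation_natGenerator, hvm, mul_one, ← WithZero.exp_nsmul]
    simp
  have h64 : v.valuation ℚ (64 : ℚ) = 1 := by
    have h : ¬ (natGenerator v : ℤ) ∣ 64 := by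
      intro h
      have h' : natGenerator v ∣ 2 ^ 6 := by exact_mod_cast h
      exact hp2 ((Nat.prime_dvd_prime_iff_eq hp Nat.prime_two).mp (hp.dvd_of_dvd_pow h'))
    have := Rat.valuation_intCast_eq_one v (n := 64) h
    exact_mod_cast this
  have hΔ : v.valuation ℚ (⟨0, 0, 0, -(D : ℚ), 0⟩ : WeierstrassCurve ℚ).Δ = WithZero.exp (-(3 * e : ℤ)) := by
    rw [Δ_rat, Valuation.map_mul, Valuation.map_pow, h64, hvD, one_mul, ← WithZero.exp_nsmul]
    congr 1; ring
  have hc₄ : v.valuation ℚ (⟨0, 0, 0, -(D : ℚ), 0⟩ : WeierstrassCurve ℚ).c₄ < 1 := by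
    rw [c₄_rat, Valuation.map_mul, hvD]
    have h48 : v.valuation ℚ (48 : ℚ) ≤ 1 := by
      have := Rat.valuation_natCast v 48
      rw [Nat.cast_ofNat] at this
      rw [this]; exact HeightOneSpectrum.intValuation_le_one _ _
    calc v.valuation ℚ (48 : ℚ) * WithZero.exp (-(e : ℤ)) ≤ 1 * WithZero.exp (-(e : ℤ)) := by gcongr
      _ < 1 := by rw [one_mul, ← WithZero.exp_zero, WithZero.exp_lt_exp]; omega
  refine hasAdditiveReductionAt_of_valuation v _ (by simp) (by simp) (by simp) ?_ (by simp) ?_ ?_ hc₄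
  · show v.valuation ℚ (-(D : ℚ)) ≤ 1
    rw [Valuation.map_neg, Rat.valuation_intCast]; exact HeightOneSpectrum.intValuation_le_one _ _
  · rw [hΔ, WithZero.exp_lt_exp]; omega
  · rw [hΔ, ← WithZero.exp_zero, WithZero.exp_lt_exp]; omega

/-- **`E_D` has additive reduction at `2`** for `D ≠ 0` with `16 ∤ D` (`-D = 2^r A₀`, `A₀` odd, `r ≤ 3`: the tree's Tate–Kraus
analysis `hasAdditiveReductionAt_two_mk_pow_mul_odd` of `y² = x³ + 2^r A₀ x`; Ireland–Rosen's `χ(P) = 0` for `P ∣ 2`).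
[cite: SilvermanAEC2009, VII.5 Prop. 5.1(c)] [cite: IrelandRosen1990, Ch. 18 §6 («If `P` divides `2D` define `χ(P) = 0`»)] -/
theorem hasAdditiveReductionAt_two (hD : D ≠ 0) (hv : natGenerator v = 2) (hD4 : ¬ (2 : ℤ) ^ 4 ∣ D) :
    (⟨0, 0, 0, -(D : ℚ), 0⟩ : WeierstrassCurve ℚ).HasAdditiveReductionAt v := by
  obtain ⟨r, m, hDr, hm⟩ := exists_eq_pow_mul_not_dvd hD Nat.prime_two
  have hr : r < 4 := by
    by_contra h4
    apply hD4
    rw [hDr]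
    exact (pow_dvd_pow _ (by omega)).mul_right m
  have hmodd : Odd (-m) := by
    rw [odd_neg, ← Int.not_even_iff_odd, even_iff_two_dvd]; exact_mod_cast hm
  have hE : (⟨0, 0, 0, -(D : ℚ), 0⟩ : WeierstrassCurve ℚ) = ⟨0, 0, 0, (2 : ℚ) ^ r * ((-m : ℤ) : ℚ), 0⟩ := by
    rw [hDr]; congr 1; push_cast; ring
  rw [hE]
  exact hasAdditiveReductionAt_two_mk_pow_mul_odd v hv hr hmodd

/-- **`E_D` has additive reduction at every prime `p ∣ 2D`** with `p⁴ ∤ D` (`D ≠ 0`).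
[cite: SilvermanAEC2009, VII.5 Prop. 5.1(c)] [cite: IrelandRosen1990, Ch. 18 §6 («If `P` divides `2D` define `χ(P) = 0`»)] -/
theorem hasAdditiveReductionAt_of_dvd (hD : D ≠ 0) (hpD : (natGenerator v : ℤ) ∣ 2 * D)
    (hD4 : ¬ (natGenerator v : ℤ) ^ 4 ∣ D) :
    (⟨0, 0, 0, -(D : ℚ), 0⟩ : WeierstrassCurve ℚ).HasAdditiveReductionAt v := by
  by_cases hv : natGenerator v = 2
  · exact hasAdditiveReductionAt_two v hD hv (by rw [hv] at hD4; exact_mod_cast hD4)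
  · refine hasAdditiveReductionAt_of_odd v hD hv ?_ hD4
    have hp' : Prime (natGenerator v : ℤ) := Nat.prime_iff_prime_int.mp (prime_natGenerator v)
    rcases hp'.dvd_or_dvd hpD with h2 | h
    · exfalso
      have : natGenerator v ∣ 2 := by exact_mod_cast h2
      exact hv ((Nat.prime_dvd_prime_iff_eq (prime_natGenerator v) Nat.prime_two).mp this)
    · exact h

/-- **`a_{p^{k+1}}(E_D) = 0` for `p ∣ 2D`** (`p⁴ ∤ D`, `D ≠ 0`): additive reduction, Euler factor `1`.
[cite: IrelandRosen1990, Ch. 18 §6 («If `P` divides `2D` define `χ(P) = 0`»)] [cite: SilvermanAEC2009, §C.16 (definition of L_v(T))] -/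
theorem lFunction_apply_prime_pow_of_dvd (hD : D ≠ 0) {p : ℕ} (hp : p.Prime) (hpD : (p : ℤ) ∣ 2 * D)
    (hD4 : ¬ (p : ℤ) ^ 4 ∣ D) (k : ℕ) :
    (⟨0, 0, 0, -(D : ℚ), 0⟩ : WeierstrassCurve ℚ).LFunction (p ^ (k + 1)) = 0 := by
  set v : HeightOneSpectrum (NumberField.RingOfIntegers ℚ) := primesEquiv.symm ⟨p, hp⟩ with hvdef
  have hvp : (primesEquiv v : ℕ) = p := by rw [hvdef, Equiv.apply_symm_apply]
  have hadd : (⟨0, 0, 0, -(D : ℚ), 0⟩ : WeierstrassCurve ℚ).HasAdditiveReductionAt v :=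
    hasAdditiveReductionAt_of_dvd v hD (by rw [show natGenerator v = p from hvp]; exact hpD)
      (by rw [show natGenerator v = p from hvp]; exact hD4)
  have h1 : (⟨0, 0, 0, -(D : ℚ), 0⟩ : WeierstrassCurve ℚ).LFunction p = 0 := by
    have := lFunction_apply_eq_zero_of_hasAdditiveReductionAt v _ hadd
    rwa [hvp] at this
  induction k using Nat.strong_induction_on with
  | _ k ih =>
    rcases k with _ | k
    · rw [zero_add, pow_one]; exact h1
    · have h := (⟨0, 0, 0, -(D : ℚ), 0⟩ : WeierstrassCurve ℚ).LFunction_apply_prime_pow_add_two v k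
      rw [hvp, if_neg hadd.not_hasGoodReductionAt, h1, zero_mul, zero_mul, sub_zero] at h
      exact h

end Additive

/-! ### §3 The inert primes `p ≡ 3 (4)`, `p ∤ D` -/

section Inert

/-- **`a_p(E_D) = 0` for `p ≡ 3 (mod 4)`, `p ∤ D`** («By Theorem 5, `N_p = p + 1` so that `a_p = 0`»; the coefficient of
Mathlib's `L`-function at a good prime of the integral model is `p + 1 − #Ẽ(𝔽_p)`).
[cite: IrelandRosen1990, Ch. 18 §6, proof of Theorem 7, case p ≡ 3 (4) (PDF p. 304)] [cite: IrelandRosen1990, Ch. 18 §4, Theorem 5, first assertion] -/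
theorem lFunction_apply_prime_of_mod_four_eq_three {p : ℕ} (hp : p.Prime) (hp3 : p % 4 = 3)
    (hpD : ¬ (p : ℤ) ∣ D) : (⟨0, 0, 0, -(D : ℚ), 0⟩ : WeierstrassCurve ℚ).LFunction p = 0 := by
  haveI := Fact.mk hp
  have hp2D : ¬ (p : ℤ) ∣ 2 * D := by
    intro h
    rcases (Nat.prime_iff_prime_int.mp hp).dvd_or_dvd h with h2 | h2
    · have : p ∣ 2 := by exact_mod_cast h2
      have := (Nat.prime_dvd_prime_iff_eq hp Nat.prime_two).mp this
      subst this; norm_num at hp3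
    · exact hpD h2
  rw [← map_int, Automorphic.lFunction_map_apply_prime_of_not_dvd _ hp (not_dvd_Δ_int hp hp2D),
    Automorphic.frobeniusTrace, Automorphic.numPointsMod]
  have hmap : (⟨0, 0, 0, -D, 0⟩ : WeierstrassCurve ℤ).map (Int.castRingHom (ZMod p)) = ⟨0, 0, 0, -(D : ZMod p), 0⟩ := by
    simp [WeierstrassCurve.map]
  rw [hmap, IrelandRosen1990_card_points_three_mod_four hp3 hpD]
  push_cast
  ring

/-- **The inert Euler factor `(1 + p^{1-2s})⁻¹`**: for `p ≡ 3 (mod 4)`, `p ∤ D`: `a_{p^{2m}}(E_D) = (-p)^m` and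
`a_{p^{2m+1}}(E_D) = 0` (`a_p = 0` and the good-reduction recursion `a_{p^{k+2}} = a_p a_{p^{k+1}} − p a_{p^k}`).
[cite: IrelandRosen1990, Ch. 18 §6, Theorem 7 and its proof, case p ≡ 3 (4) (PDF p. 304)] [cite: DiamondShurman2005, §8.8 (8.44)] -/
theorem lFunction_apply_prime_pow_of_mod_four_eq_three {p : ℕ} (hp : p.Prime) (hp3 : p % 4 = 3)
    (hpD : ¬ (p : ℤ) ∣ D) (m : ℕ) :
    (⟨0, 0, 0, -(D : ℚ), 0⟩ : WeierstrassCurve ℚ).LFunction (p ^ (2 * m)) = (-(p : ℤ)) ^ m ∧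
      (⟨0, 0, 0, -(D : ℚ), 0⟩ : WeierstrassCurve ℚ).LFunction (p ^ (2 * m + 1)) = 0 := by
  have hp2D : ¬ (p : ℤ) ∣ 2 * D := by
    intro h
    rcases (Nat.prime_iff_prime_int.mp hp).dvd_or_dvd h with h2 | h2
    · have : p ∣ 2 := by exact_mod_cast h2
      have := (Nat.prime_dvd_prime_iff_eq hp Nat.prime_two).mp this
      subst this; norm_num at hp3
    · exact hpD h2
  set v : HeightOneSpectrum (NumberField.RingOfIntegers ℚ) := primesEquiv.symm ⟨p, hp⟩ with hvdef
  have hvp : (primesEquiv v : ℕ) = p := by rw [hvdef, Equiv.apply_symm_apply]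
  have hgood : (⟨0, 0, 0, -(D : ℚ), 0⟩ : WeierstrassCurve ℚ).HasGoodReductionAt v := by
    rw [← map_int]
    refine hasGoodReductionAt_map_of_not_dvd _ v ?_
    rw [hvp]; exact not_dvd_Δ_int hp hp2D
  have h0 := lFunction_apply_prime_of_mod_four_eq_three hp hp3 hpD (D := D)
  have hrec : ∀ k, (⟨0, 0, 0, -(D : ℚ), 0⟩ : WeierstrassCurve ℚ).LFunction (p ^ (k + 2)) =
      -(p : ℤ) * (⟨0, 0, 0, -(D : ℚ), 0⟩ : WeierstrassCurve ℚ).LFunction (p ^ k) := by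
    intro k
    have h := (⟨0, 0, 0, -(D : ℚ), 0⟩ : WeierstrassCurve ℚ).LFunction_apply_prime_pow_add_two v k
    rw [hvp, if_pos hgood, h0, zero_mul, zero_sub] at h
    rw [h]; ring
  induction m with
  | zero =>
    refine ⟨?_, ?_⟩
    · rw [mul_zero, pow_zero, pow_zero]
      exact (⟨0, 0, 0, -(D : ℚ), 0⟩ : WeierstrassCurve ℚ).isMultiplicative_LFunction.map_one
    · rw [mul_zero, zero_add, pow_one]; exact h0
  | succ m ih =>
    refine ⟨?_, ?_⟩
    · rw [show 2 * (m + 1) = 2 * m + 2 by ring, hrec, ih.1]; ring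
    · rw [show 2 * (m + 1) + 1 = (2 * m + 1) + 2 by ring, hrec, ih.2]; ring

end Inert

/-! ### §4 The split primes `p ≡ 1 (4)`, `p ∤ D`: `a_p = ū π + u π̄` with `u = (D/π)₄` -/

section Split

/-- A fourth root of unity of `GaussianInt` is a power of `i`. [cite: IrelandRosen1990, Ch. 9 §7 (the units `±1, ±i`)] -/
theorem exists_eq_I_pow_of_pow_four_eq_one {u : GaussianInt} (hu : u ^ 4 = 1) : ∃ k : ℕ, k < 4 ∧ u = ⟨0, 1⟩ ^ k := by
  have hunit : IsUnit u := ⟨⟨u, u ^ 3, by rw [← pow_succ', hu], by rw [← pow_succ, hu]⟩, rfl⟩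
  rcases eq_of_isUnit hunit with rfl | rfl | rfl | rfl
  · exact ⟨0, by norm_num, by decide⟩
  · exact ⟨2, by norm_num, by decide⟩
  · exact ⟨1, by norm_num, by decide⟩
  · exact ⟨3, by norm_num, by decide⟩

/-- `u ū = 1` for a fourth root of unity `u ∈ GaussianInt`. [cite: IrelandRosen1990, Ch. 9 §8, Prop. 9.8.3 (c)] -/
theorem mul_star_of_pow_four_eq_one {u : GaussianInt} (hu : u ^ 4 = 1) : u * star u = 1 := by
  obtain ⟨k, -, rfl⟩ := exists_eq_I_pow_of_pow_four_eq_one hu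
  rw [star_pow, ← mul_pow, show (⟨0, 1⟩ : GaussianInt) * star ⟨0, 1⟩ = 1 by decide, one_pow]

/-- **`a_p(E_D) = ū π + u π̄` at a split prime** (Ireland–Rosen Ch. 18 §4 Theorem 5, second assertion, PROVED in the tree as
`IrelandRosen1990_card_points_one_mod_four_holds`): for `p ≡ 1 (4)`, `p ∤ D`, `π` primary of norm `p` and `u` a fourth root
of unity with `π ∣ D^{(p-1)/4} − u` (Euler's criterion: `u = (D/π)₄`), the `p`-th coefficient of Mathlib's `L(E_D, s)` is
`ū π + u π̄ = \\overline{(D/π)₄} π + (D/π)₄ π̄`, read in `GaussianInt`. [cite: IrelandRosen1990, Ch. 18 §4 Theorem 5 and §6 proof of Theorem 7 (PDF pp. 301, 304)] -/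
theorem lFunction_apply_prime_split {p : ℕ} (hp : p.Prime) (hp1 : p % 4 = 1) (hpD : ¬ (p : ℤ) ∣ D)
    {π : GaussianInt} (hπ : IsPrimary π) (hπp : π.norm = p) {u : GaussianInt} (hu : u ^ 4 = 1)
    (hdvd : π ∣ (D : GaussianInt) ^ ((p - 1) / 4) - u) :
    (((⟨0, 0, 0, -(D : ℚ), 0⟩ : WeierstrassCurve ℚ).LFunction p : ℤ) : GaussianInt) = star u * π + u * star π := by
  haveI := Fact.mk hp
  have hp2D : ¬ (p : ℤ) ∣ 2 * D := by
    intro h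
    rcases (Nat.prime_iff_prime_int.mp hp).dvd_or_dvd h with h2 | h2
    · have : p ∣ 2 := by exact_mod_cast h2
      have := (Nat.prime_dvd_prime_iff_eq hp Nat.prime_two).mp this
      subst this; norm_num at hp1
    · exact hpD h2
  obtain ⟨k, -, rfl⟩ := exists_eq_I_pow_of_pow_four_eq_one hu
  have hcount := IrelandRosen1990_card_points_one_mod_four_holds hp1 hpD hπp ((isPrimary_iff_dvd π).mp hπ) hdvd
  have hap : (⟨0, 0, 0, -(D : ℚ), 0⟩ : WeierstrassCurve ℚ).LFunction p =
      (p : ℤ) + 1 - (Nat.card (⟨0, 0, 0, -(D : ZMod p), 0⟩ : WeierstrassCurve (ZMod p)).toAffine.Point : ℤ) := by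
    rw [← map_int, Automorphic.lFunction_map_apply_prime_of_not_dvd _ hp (not_dvd_Δ_int hp hp2D),
      Automorphic.frobeniusTrace, Automorphic.numPointsMod]
    have hmap : (⟨0, 0, 0, -D, 0⟩ : WeierstrassCurve ℤ).map (Int.castRingHom (ZMod p)) = ⟨0, 0, 0, -(D : ZMod p), 0⟩ := by
      simp [WeierstrassCurve.map]
    rw [hmap]
  rw [hap, hcount]
  have hsum : ∀ w : GaussianInt, w + star w = ((2 * w.re : ℤ) : GaussianInt) := fun w ↦ by ext <;> simp [two_mul]
  have : ⟨0, 1⟩ ^ k * star π = star (star ((⟨0, 1⟩ : GaussianInt) ^ k) * π) := by rw [star_mul, star_star, mul_comm]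
  rw [this, hsum]
  push_cast
  ring

/-- **The split Euler factor `(1 − ūπ p^{-s})(1 − uπ̄ p^{-s})`**: with the data of `lFunction_apply_prime_split`,
`a_{p^k}(E_D) = Σ_{j=0}^{k} (ūπ)^j (uπ̄)^{k-j}` («`1 - a_p p^{-s} + p^{1-2s} = (1 - χ(P)NP^{-s})(1 - χ(P̄)NP̄^{-s})`»; recursion
`a_{p^{k+2}} = a_p a_{p^{k+1}} − p a_{p^k}` at the good prime `p`, and `(ūπ)(uπ̄) = p`).
[cite: IrelandRosen1990, Ch. 18 §6, proof of Theorem 7, case p ≡ 1 (4) (PDF p. 304)] [cite: DiamondShurman2005, §8.8 (8.44)] -/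
theorem lFunction_apply_prime_pow_split {p : ℕ} (hp : p.Prime) (hp1 : p % 4 = 1) (hpD : ¬ (p : ℤ) ∣ D)
    {π : GaussianInt} (hπ : IsPrimary π) (hπp : π.norm = p) {u : GaussianInt} (hu : u ^ 4 = 1)
    (hdvd : π ∣ (D : GaussianInt) ^ ((p - 1) / 4) - u) (k : ℕ) :
    (((⟨0, 0, 0, -(D : ℚ), 0⟩ : WeierstrassCurve ℚ).LFunction (p ^ k) : ℤ) : GaussianInt) =
      ∑ j ∈ Finset.range (k + 1), (star u * π) ^ j * (u * star π) ^ (k - j) := by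
  haveI := Fact.mk hp
  have hp2D : ¬ (p : ℤ) ∣ 2 * D := by
    intro h
    rcases (Nat.prime_iff_prime_int.mp hp).dvd_or_dvd h with h2 | h2
    · have : p ∣ 2 := by exact_mod_cast h2
      have := (Nat.prime_dvd_prime_iff_eq hp Nat.prime_two).mp this
      subst this; norm_num at hp1
    · exact hpD h2
  set E : WeierstrassCurve ℚ := ⟨0, 0, 0, -(D : ℚ), 0⟩ with hE
  set v : HeightOneSpectrum (NumberField.RingOfIntegers ℚ) := primesEquiv.symm ⟨p, hp⟩ with hvdef
  have hvp : (primesEquiv v : ℕ) = p := by rw [hvdef, Equiv.apply_symm_apply]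
  have hgood : E.HasGoodReductionAt v := by
    rw [hE, ← map_int]
    refine hasGoodReductionAt_map_of_not_dvd _ v ?_
    rw [hvp]; exact not_dvd_Δ_int hp hp2D
  have hrec : ∀ k, E.LFunction (p ^ (k + 2)) = E.LFunction p * E.LFunction (p ^ (k + 1)) - (p : ℤ) * E.LFunction (p ^ k) := by
    intro k
    have h := E.LFunction_apply_prime_pow_add_two v k
    rw [hvp, if_pos hgood] at h
    exact h
  have h1 := lFunction_apply_prime_split hp hp1 hpD hπ hπp hu hdvd
  rw [← hE] at h1
  set π' : GaussianInt := star u * π with hπ'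
  set σ : GaussianInt := u * star π with hσ
  have hp_eq : (p : GaussianInt) = π' * σ := by
    rw [hπ', hσ, natCast_eq_mul_star hπp]
    linear_combination (-(π * star π)) * mul_star_of_pow_four_eq_one hu
  set T : ℕ → GaussianInt := fun k ↦ ∑ j ∈ Finset.range (k + 1), π' ^ j * σ ^ (k - j) with hT
  suffices H : ∀ k, ((E.LFunction (p ^ k) : ℤ) : GaussianInt) = T k ∧ ((E.LFunction (p ^ (k + 1)) : ℤ) : GaussianInt) = T (k + 1) from
    (H k).1
  intro k
  induction k with
  | zero =>
    constructor
    · rw [pow_zero, E.isMultiplicative_LFunction.map_one]; simp [hT]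
    · rw [zero_add, pow_one, h1]
      simp only [hT, Finset.sum_range_succ, Finset.sum_range_zero, pow_zero, pow_one, Nat.sub_zero, Nat.sub_self,
        one_mul, mul_one, zero_add]
      rw [hπ', hσ]; ring
  | succ k ih =>
    refine ⟨ih.2, ?_⟩
    rw [show k + 1 + 1 = k + 2 by ring, hrec k, Int.cast_sub, Int.cast_mul, Int.cast_mul, ih.1, ih.2, h1,
      Int.cast_natCast, hp_eq]
    have hTrec : T (k + 2) = (π' + σ) * T (k + 1) - π' * σ * T k := by
      simp only [hT]; exact sum_pow_mul_pow_rec π' σ k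
    rw [hTrec, hπ', hσ]

end Split

end QuarticTwist

end Literature.NumberTheory.EllipticCurves

end
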